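import Literature.NumberTheory.LFunctions.ZetaZeroWindowsExplicit
import Literature.NumberTheory.LFunctions.ZetaArgHSW
import HarnessLib

/-!
# Zeros of `ζ` in windows from the proved `|S(T)| ≤ 0.1035 log T + 0.2395 log log T + 4.92` (unconditional)

Topic `Literature/NumberTheory/LFunctions` (explicit zero statistics; unconditional — nothing here bears
on the Riemann Hypothesis). THEOREMS only (no definitions, no named facts, no instances, no notation):
the tree's PROVED argument bound
`Literature.NumberTheory.LFunctions.abs_zetaArgS_le_hsw` (`ZetaArgHSW.lean`; the method of
[HSW22, Thm. 1.3]) fed DIRECTLY into the PROVED window mechanism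
`Literature.NumberTheory.LFunctions.ZetaZeroWindows.count_diff_le` of `ZetaZeroWindowsExplicit.lean`
(`N(T+H) − N(T) ≤ (H/2π) log((T+H)/2π) + |S(T+H)| + |S(T)| + 2.4/(πT)`, `T ≥ 2`).

What the tree already has (cite, do not restate): the composition
`Literature.NumberTheory.LFunctions.zetaZeroCount_hasanalizade_shen_wong.window_le` applied to the
discharged fact `Literature.NumberTheory.LFunctions.zetaZeroCount_hasanalizade_shen_wong_holds`
([HSW22, Cor. 1.2] used at both ends of the window) gives, for every `T ≥ e`, `H ≥ 0`,
`N(T+H) − N(T) ≤ (H/2π) log((T+H)/2π) + 0.2076 log(T+H) + 0.5146 log log(T+H) + 18.735`.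
Going through `S` twice instead of through `|N − main|` twice roughly HALVES the additive surplus
(`18.735 ↦ 9.841`, `0.5146 ↦ 0.4790`, slope `0.2076 ↦ 0.2070`) above the height
`T₀ = 30 610 046 000` of `abs_zetaArgS_le_hsw` — the regime of every window used at ordinates
`γ ≥ 3·10¹²`.

## Main results (all PROVED, 0 sorry)

* `ZetaZeroWindows.count_diff_le_hsw` — for `T ≥ 30 610 046 000`, `H ≥ 0`:
  `N(T+H) − N(T) ≤ (H/2π) log((T+H)/2π) + 0.2070 log(T+H) + 0.4790 log log(T+H) + 9.841`;
* `ZetaZeroWindows.unit_shell_le_hsw` — for `γ ≥ 30 610 046 001`: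
  `N(γ+1) − N(γ−1) ≤ (1/π) log((γ+1)/2π) + 0.2070 log(γ+1) + 0.4790 log log(γ+1) + 9.841`;
* `ZetaZeroWindows.radius_window_le_hsw` — for `γ − r ≥ 30 610 046 000`, `r ≥ 0`:
  `N(γ+r) − N(γ−r) ≤ (r/π) log((γ+r)/2π) + 0.2070 log(γ+r) + 0.4790 log log(γ+r) + 9.841`
  (at `r = C/log γ` the main term is `≤ C/π + o(1)`: the number of zeros of `ζ`, counted with
  multiplicity, within `C/log γ` of the ordinate `γ` is at most `0.2070 log γ + O(log log γ)`).

## References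

* E. Hasanalizade, Q. Shen, P.-J. Wong, *Counting zeros of the Riemann zeta function*,
  J. Number Theory 235 (2022) 219–241, Thm. 1.3 and Cor. 1.2. [HasanalizadeShenWong2022]
* E. C. Titchmarsh, *The Theory of the Riemann Zeta-Function*, 2nd ed., §9.2 Thm. 9.2. [Titchmarsh1986]
-/

noncomputable section

open Real

namespace Literature.NumberTheory.LFunctions

namespace ZetaZeroWindows

/-- `2.4/(πT) ≤ 0.001` for `T ≥ 30 610 046 000`. [cite: Titchmarsh1986, §9.2] -/
private theorem remainder_le_hsw {T : ℝ} (hT : 30610046000 ≤ T) : 2.4 / (π * T) ≤ 0.001 := by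
  have hπ := Real.pi_gt_three
  rw [div_le_iff₀ (by positivity)]
  nlinarith

/-- **Zeros in a window from the proved HSW-type bound for `S`**: for `T ≥ 30 610 046 000` and
`H ≥ 0`, `N(T+H) − N(T) ≤ (H/2π) log((T+H)/2π) + 0.2070 log(T+H) + 0.4790 log log(T+H) + 9.841`
(`ZetaZeroWindows.count_diff_le` with `abs_zetaArgS_le_hsw` at `T` and at `T+H`, and
`2.4/(πT) ≤ 0.001`). Compare `zetaZeroCount_hasanalizade_shen_wong.window_le` (constants
`0.2076, 0.5146, 18.735`, all `T ≥ e`). [cite: HasanalizadeShenWong2022, Thm. 1.3] -/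
theorem count_diff_le_hsw {T H : ℝ} (hT : 30610046000 ≤ T) (hH : 0 ≤ H) :
    (zetaZeroCount (T + H) : ℝ) - zetaZeroCount T ≤
      H / (2 * π) * Real.log ((T + H) / (2 * π)) + 0.2070 * Real.log (T + H) +
        0.4790 * Real.log (Real.log (T + H)) + 9.841 := by
  have h := count_diff_le (show (2 : ℝ) ≤ T by linarith) hH
  have hS1 := abs_zetaArgS_le_hsw hT
  have hS2 := abs_zetaArgS_le_hsw (show (30610046000 : ℝ) ≤ T + H by linarith)
  have hT0 : 0 < T := by linarith
  have hlog1 : 1 ≤ Real.log T := by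
    rw [Real.le_log_iff_exp_le hT0]
    have := Real.exp_one_lt_d9
    linarith
  have hlog : Real.log T ≤ Real.log (T + H) := Real.log_le_log hT0 (by linarith)
  have hll : Real.log (Real.log T) ≤ Real.log (Real.log (T + H)) :=
    Real.log_le_log (by linarith) hlog
  have hr := remainder_le_hsw hT
  linarith

/-- **Unit shell** (`|γ′ − γ| ≤ 1`): for `γ ≥ 30 610 046 001`,
`N(γ+1) − N(γ−1) ≤ (1/π) log((γ+1)/2π) + 0.2070 log(γ+1) + 0.4790 log log(γ+1) + 9.841`.
[cite: HasanalizadeShenWong2022, Thm. 1.3] -/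
theorem unit_shell_le_hsw {γ : ℝ} (hγ : 30610046001 ≤ γ) :
    (zetaZeroCount (γ + 1) : ℝ) - zetaZeroCount (γ - 1) ≤
      1 / π * Real.log ((γ + 1) / (2 * π)) + 0.2070 * Real.log (γ + 1) +
        0.4790 * Real.log (Real.log (γ + 1)) + 9.841 := by
  have h := count_diff_le_hsw (T := γ - 1) (H := 2) (by linarith) (by norm_num)
  have e1 : γ - 1 + 2 = γ + 1 := by ring
  have e2 : (2 : ℝ) / (2 * π) = 1 / π := by
    rw [div_eq_div_iff (by positivity) (by positivity)]; ring
  rw [e1, e2] at h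
  exact h

/-- **Radius-`r` window about an ordinate**: for `γ − r ≥ 30 610 046 000` and `r ≥ 0`,
`N(γ+r) − N(γ−r) ≤ (r/π) log((γ+r)/2π) + 0.2070 log(γ+r) + 0.4790 log log(γ+r) + 9.841`; at
`r = C/log γ` the main term is `≤ C/π + o(1)`, so the zeros within `C/log γ` of `γ` number at most
`0.2070 log γ + O(log log γ)` — Titchmarsh's `N(T+h) − N(T) = O(log T)` with the slope `2 · 0.1035`.
[cite: HasanalizadeShenWong2022, Thm. 1.3] [cite: Titchmarsh1986, §9.2 Thm. 9.2] -/
theorem radius_window_le_hsw {γ r : ℝ} (hγ : 30610046000 ≤ γ - r) (hr : 0 ≤ r) :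
    (zetaZeroCount (γ + r) : ℝ) - zetaZeroCount (γ - r) ≤
      r / π * Real.log ((γ + r) / (2 * π)) + 0.2070 * Real.log (γ + r) +
        0.4790 * Real.log (Real.log (γ + r)) + 9.841 := by
  have h := count_diff_le_hsw (T := γ - r) (H := 2 * r) hγ (by linarith)
  have e1 : γ - r + 2 * r = γ + r := by ring
  have e2 : (2 * r : ℝ) / (2 * π) = r / π := by
    rw [div_eq_div_iff (by positivity) (by positivity)]; ring
  rw [e1, e2] at h
  exact h

end ZetaZeroWindows

end Literature.NumberTheory.LFunctions
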